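import Summits.CriticalPhenomena.PercolationContinuityZ3.Theorems.PercNearOneGluingNoHeavyLowerTailTwoPartitionHallDual
import HarnessLib.Audit

/-!
# `NoHeavyLowerTail` (crux stmt-CriticalPhenomena-4575), master-family hierarchy P3 (gen 33): **THE CORE IS A THEOREM** —
# `CoreOn`, `CorePair`, `ThreeSetHallD ⇔ ThreeSetHallG2 ⇒ ThreeSetHallG ⇒ ThreeSetHall ⇒ ThreeSetAntipodal` all hold
# (hence SQKD `Cov(1_{A∩B},1_{A∩C}) ≥ P(A)·P(B∩C∖A)` for increasing events under every product measure, `sqkd_of_threeSetAntipodal`)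

Support file (seat `prim-masterthm-p3`; `--supports stmt-CriticalPhenomena-4575`; memo
`run/shared/lean/prim/prim-masterthm/FROM-prim-masterthm-p3-g33-CORE-PROVED.md`, HIERARCHY §40).  Companion of `…TwoPartitionHallDual`
(the dual functionals `Λ_S`, the Möbius steps, the shattering descent) and `…TwoPartitionHallSplit` (`CorePair ↔ ThreeSetHallD →
ThreeSetAntipodal`, which were CONJECTURES until this file).

THE THEOREM (this work).  Let `𝒴 ⊆ 𝒱` be up-sets of `2^α` (`α` finite), `ℰ = 𝒱 ∖ 𝒴`, `C = {S : ∃ e, e' ∈ ℰ, S ⊆ e, e' ⊆ Sᶜ}`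
(`corrSet`) and `Src = {S : Sᶜ ∈ 𝒱} ∖ C` (`srcSet`).  Then
* `core_rows_indep`: the rows `[S ⊆ ·]|_𝒴`, `S ∈ Src`, are LINEARLY INDEPENDENT.  (If `h = ∑_S c(S)[S ⊆ ·]` vanishes on `𝒴`
  then `Λ_S(h) = ±c(S)`; for `S ∈ C` this is `0`, and since `h` lives on `ℰ` and `𝒱 ∩ ↓ℰ = ℰ` it reads
  `∑_{R ∈ ℰ, R ∩ S = ∅} k(R) = 0` with `k(R) = (−1)^{#R} ∑_{T ∈ ℰ, T ⊇ R} (−1)^{#T} h(T)`; every set shattered by `ℰ` lies in `C`,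
  so the shattering descent gives `k = 0` on `ℰ`, hence `h = 0` on `ℰ`, hence on `𝒱`, hence `c(S) = ±Λ_S(h) = 0`.)
* `hall_condition`, `exists_core_injection`: hence (rank ≤ number of columns, P. Hall) there is an injection `φ : Src → 𝒴` with
  `S ⊆ φ(S)` — the Hall form of the core conjectured in `…TwoPartitionHallCore` (verified there by computer for `n ≤ 6`).
* `coreOn_holds`, `corePair_holds`, `threeSetHallD_holds`, `threeSetHallG2_holds`, `threeSetHallG_holds`, `threeSetHall_holds`,
  `threeSetAntipodal_holds`, `threeSetN_nonneg`: the whole tower of `…TwoPartitionThreeSet` / `…HallForm` / `…HallCore` / `…HallSplit`.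
So the three-set antipodal functional `#(𝒜ℬ𝒞) + #(𝒜ℬ𝒞 ∩ 𝒜ᶜˢ) − #(𝒜ℬ ∩ 𝒜ᶜˢ𝒞ᶜˢ) − #(𝒜 ∩ ℬᶜˢ𝒞ᶜˢ)` is nonnegative for all up-sets
of every finite cube, and (`…TwoPartitionFibre.sqkd_of_threeSetAntipodal`) `P(AB)P(AC) + P(A)P(BC) ≤ (1 + P(A))P(ABC)` for increasing
`A, B, C` under every product measure on every finite cube.
HONEST LABEL: complete proofs, standard axioms (Hall's theorem and `finrank` from Mathlib).  This settles the lane's conjectures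
`ThreeSetAntipodal` (gen 25), `ThreeSetHall/G/G2` (gen 31), `ThreeSetHallD`/`CorePair` (gen 32); it does NOT touch `WeightedBase`,
`KeySandwich`/KEY4 or Sahi's `C_k` (those IMPLY `ThreeSetAntipodal`, not conversely), and nothing here bears on the (closed) crux. [this work]
-/

namespace Summit.CriticalPhenomena.PercolationContinuityZ3.Theorems.TwoPartition

open Finset
open scoped FinsetFamily

/-! ### The nested pair `𝒴 ⊆ 𝒱`: the rows `[S ⊆ ·]|_𝒴`, `S ∈ σ𝒱 ∖ C`, are linearly independent -/

section Pair
variable {α : Type*} [DecidableEq α] [Fintype α]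

/-- The correction family `C = {S : ∃ e ∈ ℰ, S ⊆ e and ∃ e' ∈ ℰ, e' ⊆ Sᶜ}`, `ℰ = 𝒱 ∖ 𝒴` — the same filter as in
`sum_chi_mul_coreFn` / `coreFn`. [this work] -/
def corrSet (𝒴 𝒱 : Finset (Finset α)) : Finset (Finset α) :=
  univ.filter fun T => (∃ e ∈ 𝒱 \ 𝒴, T ⊆ e) ∧ (∃ e ∈ 𝒱 \ 𝒴, e ⊆ Tᶜ)

/-- Membership in the correction family. [this work] -/
theorem mem_corrSet {𝒴 𝒱 : Finset (Finset α)} {S : Finset α} :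
    S ∈ corrSet 𝒴 𝒱 ↔ (∃ e ∈ 𝒱 \ 𝒴, S ⊆ e) ∧ (∃ e ∈ 𝒱 \ 𝒴, e ⊆ Sᶜ) := by
  simp only [corrSet, mem_filter, mem_univ, true_and]

/-- Members of the correction family have their complement in `𝒱` (`C ⊆ σ𝒱`). [this work] -/
theorem compl_mem_of_mem_corrSet {𝒴 𝒱 : Finset (Finset α)} (h𝒱 : IsUpperSet (𝒱 : Set (Finset α))) {S : Finset α}
    (hS : S ∈ corrSet 𝒴 𝒱) : Sᶜ ∈ 𝒱 := by
  obtain ⟨-, e, he, heS⟩ := mem_corrSet.1 hS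
  exact h𝒱 heS (mem_sdiff.1 he).1

/-- The function `h = ∑_U c(U)·[U ⊆ ·]` with coefficient vector `c`. [this work] -/
def hfun (c : Finset α → ℚ) (T : Finset α) : ℚ := ∑ U, c U * incl U T

/-- `Λ_S(h) = c(S)·(−1)^{#S}` when `c` is supported on `σ𝒱` and `Sᶜ ∈ 𝒱` (linearity + `lam_incl`). [this work] -/
theorem lam_hfun {𝒱 : Finset (Finset α)} (h𝒱 : IsUpperSet (𝒱 : Set (Finset α))) {S : Finset α} (hS : Sᶜ ∈ 𝒱)
    {c : Finset α → ℚ} (hc : ∀ U, c U ≠ 0 → Uᶜ ∈ 𝒱) : lam 𝒱 S (hfun c) = c S * sgn S := by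
  have h1 : lam 𝒱 S (hfun c) = ∑ U, c U * lam 𝒱 S (incl U) := by
    unfold lam hfun
    have e : ∀ T, (if T ∈ 𝒱 then sgn T * wfun 𝒱 S T * ∑ U, c U * incl U T else 0)
        = ∑ U, c U * (if T ∈ 𝒱 then sgn T * wfun 𝒱 S T * incl U T else 0) := by
      intro T
      by_cases hT : T ∈ 𝒱
      · simp only [if_pos hT, Finset.mul_sum]
        exact Finset.sum_congr rfl fun U _ => by ring
      · simp only [if_neg hT, mul_zero, Finset.sum_const_zero]
    rw [Finset.sum_congr rfl fun T _ => e T, Finset.sum_comm]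
    exact Finset.sum_congr rfl fun U _ => by rw [Finset.mul_sum]
  have h2 : ∀ U, c U * lam 𝒱 S (incl U) = if U = S then c U * sgn U else 0 := by
    intro U
    by_cases hU : c U = 0
    · rw [hU, zero_mul, zero_mul, ite_self]
    · rw [lam_incl h𝒱 hS (hc U hU)]
      split_ifs <;> simp
  rw [h1, Finset.sum_congr rfl fun U _ => h2 U, Finset.sum_ite_eq']
  simp only [mem_univ, if_true]

/-- When `h` vanishes on `𝒴` (so only `T ∈ ℰ = 𝒱 ∖ 𝒴` contribute, and for such `T` every `R ∈ 𝒱` below `T` lies in `ℰ`):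
`Λ_S(h) = ∑_{R ∈ ℰ, R ∩ S = ∅} k(R)` with `k(R) = (−1)^{#R} ∑_{T ∈ ℰ, T ⊇ R} (−1)^{#T} h(T)`. [this work] -/
theorem lam_eq_sum_k {𝒴 𝒱 : Finset (Finset α)} (h𝒴 : IsUpperSet (𝒴 : Set (Finset α))) (S : Finset α)
    {f : Finset α → ℚ} (h0 : ∀ T ∈ 𝒴, f T = 0) :
    lam 𝒱 S f = ∑ R, if R ∈ 𝒱 \ 𝒴 ∧ Disjoint R S then
      sgn R * ∑ T, (if T ∈ 𝒱 \ 𝒴 ∧ R ⊆ T then sgn T * f T else 0) else 0 := by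
  -- both sides as a double sum over `(T, R)`
  have h1 : lam 𝒱 S f = ∑ T, ∑ R, (if T ∈ 𝒱 \ 𝒴 ∧ R ∈ 𝒱 \ 𝒴 ∧ R ⊆ T ∧ Disjoint R S then sgn T * sgn R * f T else 0) := by
    unfold lam wfun
    refine Finset.sum_congr rfl fun T _ => ?_
    by_cases hT : T ∈ 𝒱
    · by_cases hTY : T ∈ 𝒴
      · rw [if_pos hT, h0 T hTY, mul_zero]
        symm
        exact Finset.sum_eq_zero fun R _ => if_neg (fun h => (mem_sdiff.1 h.1).2 hTY)
      · rw [if_pos hT, Finset.mul_sum, Finset.sum_mul]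
        refine Finset.sum_congr rfl fun R _ => ?_
        by_cases hR : R ∈ 𝒱 ∧ R ⊆ T ∧ Disjoint R S
        · have hRY : R ∉ 𝒴 := fun h => hTY (h𝒴 hR.2.1 h)
          rw [if_pos hR, if_pos ⟨mem_sdiff.2 ⟨hT, hTY⟩, mem_sdiff.2 ⟨hR.1, hRY⟩, hR.2.1, hR.2.2⟩]
        · rw [if_neg hR, mul_zero, zero_mul, if_neg]
          rintro ⟨-, h2, h3, h4⟩
          exact hR ⟨(mem_sdiff.1 h2).1, h3, h4⟩
    · rw [if_neg hT]
      symm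
      exact Finset.sum_eq_zero fun R _ => if_neg (fun h => hT (mem_sdiff.1 h.1).1)
  rw [h1, Finset.sum_comm]
  refine Finset.sum_congr rfl fun R _ => ?_
  by_cases hR : R ∈ 𝒱 \ 𝒴 ∧ Disjoint R S
  · rw [if_pos hR, Finset.mul_sum]
    refine Finset.sum_congr rfl fun T _ => ?_
    by_cases hT : T ∈ 𝒱 \ 𝒴 ∧ R ⊆ T
    · rw [if_pos hT, if_pos ⟨hT.1, hR.1, hT.2, hR.2⟩]; ring
    · rw [if_neg hT, mul_zero, if_neg (fun h => hT ⟨h.1, h.2.2.1⟩)]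
  · rw [if_neg hR]
    exact Finset.sum_eq_zero fun T _ => if_neg (fun h => hR ⟨h.2.1, h.2.2.2⟩)

/-- **Linear independence of the source rows** (this work).  Let `𝒴 ⊆ 𝒱` be up-sets, `ℰ = 𝒱 ∖ 𝒴`, `C` the correction
family.  If a coefficient vector `c` supported on `{S : Sᶜ ∈ 𝒱} ∖ C` has `∑_U c(U)[U ⊆ T] = 0` for every `T ∈ 𝒴`, then
`c = 0`.  Proof: with `h = ∑ c(U)[U ⊆ ·]` (vanishing on `𝒴`), `Λ_S(h) = ±c(S)`; for `S ∈ C` this is `0`, which by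
`lam_eq_sum_k` says `∑_{R ∈ ℰ, R ∩ S = ∅} k(R) = 0`; the shattering descent gives all up-sums of `k` zero, hence `k = 0` on
`ℰ`, hence `h = 0` on `ℰ` (top-down), hence `h = 0` on `𝒱`, hence `c(S) = ±Λ_S(h) = 0`. [this work] -/
theorem core_rows_indep {𝒴 𝒱 : Finset (Finset α)} (h𝒴 : IsUpperSet (𝒴 : Set (Finset α)))
    (h𝒱 : IsUpperSet (𝒱 : Set (Finset α))) (c : Finset α → ℚ)
    (hc : ∀ S, c S ≠ 0 → Sᶜ ∈ 𝒱 ∧ S ∉ corrSet 𝒴 𝒱) (h0 : ∀ T ∈ 𝒴, hfun c T = 0) : ∀ S, c S = 0 := by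
  have hcV : ∀ U, c U ≠ 0 → Uᶜ ∈ 𝒱 := fun U h => (hc U h).1
  -- the function `k` and the vanishing of its disjoint-sums on the correction family
  set k : Finset α → ℚ := fun R => sgn R * ∑ T, (if T ∈ 𝒱 \ 𝒴 ∧ R ⊆ T then sgn T * hfun c T else 0) with hk_def
  have hD : ∀ S : Finset α, ((∃ e ∈ 𝒱 \ 𝒴, S ⊆ e) ∧ (∃ e ∈ 𝒱 \ 𝒴, e ⊆ Sᶜ)) →
      (∑ R, if R ∈ 𝒱 \ 𝒴 ∧ Disjoint R S then k R else 0) = 0 := by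
    intro S hS
    have hSmem : S ∈ corrSet 𝒴 𝒱 := mem_corrSet.2 hS
    have hSc : Sᶜ ∈ 𝒱 := compl_mem_of_mem_corrSet h𝒱 hSmem
    have hcS : c S = 0 := by
      by_contra h
      exact (hc S h).2 hSmem
    have e := lam_eq_sum_k (𝒱 := 𝒱) h𝒴 S h0
    rw [lam_hfun h𝒱 hSc hcV, hcS, zero_mul] at e
    exact e.symm
  -- descent: all up-sums vanish, hence `k = 0` on `ℰ`
  have hK := upsum_eq_zero (𝒱 \ 𝒴) k hD
  have hk : ∀ R ∈ 𝒱 \ 𝒴, k R = 0 := fun R hR => eq_zero_of_upsum_eq_zero (𝒱 \ 𝒴) k hK hR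
  -- hence `h = 0` on `ℰ`, hence on `𝒱`
  have hH : ∀ R ∈ 𝒱 \ 𝒴, (∑ T, if T ∈ 𝒱 \ 𝒴 ∧ R ⊆ T then sgn T * hfun c T else 0) = 0 := by
    intro R hR
    have := hk R hR
    rcases mul_eq_zero.1 this with h | h
    · exact absurd h (sgn_ne_zero R)
    · exact h
  have hE : ∀ T ∈ 𝒱 \ 𝒴, hfun c T = 0 := eq_zero_of_topsum_eq_zero (𝒱 \ 𝒴) (hfun c) hH
  have hV : ∀ T ∈ 𝒱, hfun c T = 0 := by
    intro T hT
    by_cases hTY : T ∈ 𝒴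
    · exact h0 T hTY
    · exact hE T (mem_sdiff.2 ⟨hT, hTY⟩)
  -- conclusion
  intro S
  by_contra hS
  have hSc := hcV S hS
  have e1 := lam_hfun h𝒱 hSc hcV
  have e2 : lam 𝒱 S (hfun c) = 0 := by
    unfold lam
    exact Finset.sum_eq_zero fun T _ => by
      by_cases hT : T ∈ 𝒱
      · rw [if_pos hT, hV T hT, mul_zero]
      · rw [if_neg hT]
  rw [e2] at e1
  rcases mul_eq_zero.1 e1.symm with h | h
  · exact hS h
  · exact sgn_ne_zero S h

end Pair

/-! ### Hall's condition, the increasing injection, and the core -/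

section Matching
variable {α : Type*} [DecidableEq α] [Fintype α]

/-- The source family `σ𝒱 ∖ C = {S : Sᶜ ∈ 𝒱} ∖ corrSet`. [this work] -/
def srcSet (𝒴 𝒱 : Finset (Finset α)) : Finset (Finset α) := 𝒱ᶜˢ \ corrSet 𝒴 𝒱

/-- Membership in the source family. [this work] -/
theorem mem_srcSet {𝒴 𝒱 : Finset (Finset α)} {S : Finset α} : S ∈ srcSet 𝒴 𝒱 ↔ Sᶜ ∈ 𝒱 ∧ S ∉ corrSet 𝒴 𝒱 := by
  rw [srcSet, mem_sdiff, mem_compls]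

/-- **Hall's condition for the sources** (this work): any finite set `s` of sources has at least `#s` neighbours
`{T ∈ 𝒴 : S ⊆ T, S ∈ s}` — because the rows `[S ⊆ ·]`, `S ∈ s`, are linearly independent vectors supported on the
neighbour coordinates (`core_rows_indep`), so `#s ≤ dim ℚ^{neighbours}`. [this work] -/
theorem hall_condition {𝒴 𝒱 : Finset (Finset α)} (h𝒴 : IsUpperSet (𝒴 : Set (Finset α)))
    (h𝒱 : IsUpperSet (𝒱 : Set (Finset α))) (s : Finset (srcSet 𝒴 𝒱)) :
    #s ≤ #(s.biUnion fun S => 𝒴.filter fun T => (S : Finset α) ⊆ T) := by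
  set N := s.biUnion fun S => 𝒴.filter fun T => (S : Finset α) ⊆ T with hN
  let v : s → (N → ℚ) := fun i T => incl ((i : srcSet 𝒴 𝒱) : Finset α) (T : Finset α)
  have hli : LinearIndependent ℚ v := by
    rw [Fintype.linearIndependent_iff]
    intro g hg
    -- the coefficient vector on all subsets
    let c : Finset α → ℚ := fun S => ∑ i : s, if ((i : srcSet 𝒴 𝒱) : Finset α) = S then g i else 0
    have hcval : ∀ i : s, c ((i : srcSet 𝒴 𝒱) : Finset α) = g i := by
      intro i
      have e : ∀ j : s, (if ((j : srcSet 𝒴 𝒱) : Finset α) = ((i : srcSet 𝒴 𝒱) : Finset α) then g j else 0)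
          = if j = i then g j else 0 := by
        intro j
        by_cases h : j = i
        · subst h; simp
        · have h' : ((j : srcSet 𝒴 𝒱) : Finset α) ≠ ((i : srcSet 𝒴 𝒱) : Finset α) := fun h2 =>
            h (Subtype.ext (Subtype.ext h2))
          rw [if_neg h', if_neg h]
      show (∑ j : s, if ((j : srcSet 𝒴 𝒱) : Finset α) = ((i : srcSet 𝒴 𝒱) : Finset α) then g j else 0) = g i
      rw [Finset.sum_congr rfl fun j _ => e j, Finset.sum_ite_eq']
      simp
    have hc : ∀ S, c S ≠ 0 → Sᶜ ∈ 𝒱 ∧ S ∉ corrSet 𝒴 𝒱 := by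
      intro S hS
      obtain ⟨i, -, hi⟩ := Finset.exists_ne_zero_of_sum_ne_zero hS
      have hiS : ((i : srcSet 𝒴 𝒱) : Finset α) = S := by
        by_contra h; rw [if_neg h] at hi; exact hi rfl
      rw [← hiS]
      exact mem_srcSet.1 (i : srcSet 𝒴 𝒱).2
    -- `hfun c T = ∑_i g i [S_i ⊆ T]`
    have hf : ∀ T, hfun c T = ∑ i : s, g i * incl ((i : srcSet 𝒴 𝒱) : Finset α) T := by
      intro T
      unfold hfun
      have e : ∀ U, c U * incl U T = ∑ i : s, (if ((i : srcSet 𝒴 𝒱) : Finset α) = U then g i * incl U T else 0) := by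
        intro U
        show (∑ i : s, if ((i : srcSet 𝒴 𝒱) : Finset α) = U then g i else 0) * incl U T = _
        rw [Finset.sum_mul]
        exact Finset.sum_congr rfl fun i _ => by split_ifs <;> simp
      rw [Finset.sum_congr rfl fun U _ => e U, Finset.sum_comm]
      refine Finset.sum_congr rfl fun i _ => ?_
      rw [Finset.sum_ite_eq]
      simp
    have h0 : ∀ T ∈ 𝒴, hfun c T = 0 := by
      intro T hT
      rw [hf]
      by_cases hTN : T ∈ N
      · have := congrFun hg ⟨T, hTN⟩
        simpa [v, Finset.sum_apply, Pi.smul_apply, smul_eq_mul] using this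
      · refine Finset.sum_eq_zero fun i _ => ?_
        have : ¬ ((i : srcSet 𝒴 𝒱) : Finset α) ⊆ T := by
          intro hsub
          apply hTN
          rw [hN, mem_biUnion]
          exact ⟨i, i.2, mem_filter.2 ⟨hT, hsub⟩⟩
        simp [incl, this]
    have hzero := core_rows_indep h𝒴 h𝒱 c hc h0
    intro i
    rw [← hcval i]
    exact hzero _
  have h1 := hli.fintype_card_le_finrank
  rw [Module.finrank_fintype_fun_eq_card, Fintype.card_coe, Fintype.card_coe] at h1
  exact h1

/-- **The increasing injection** (this work): there is an injection `φ` from the sources `{S : Sᶜ ∈ 𝒱} ∖ C` into `𝒴` with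
`S ⊆ φ(S)` (P. Hall). [this work] -/
theorem exists_core_injection {𝒴 𝒱 : Finset (Finset α)} (h𝒴 : IsUpperSet (𝒴 : Set (Finset α)))
    (h𝒱 : IsUpperSet (𝒱 : Set (Finset α))) :
    ∃ φ : srcSet 𝒴 𝒱 → Finset α, Function.Injective φ ∧ ∀ x, φ x ∈ 𝒴 ∧ (x : Finset α) ⊆ φ x := by
  obtain ⟨φ, hφ, hmem⟩ := (Finset.all_card_le_biUnion_card_iff_exists_injective
    (fun S : srcSet 𝒴 𝒱 => 𝒴.filter fun T => (S : Finset α) ⊆ T)).1 (hall_condition h𝒴 h𝒱)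
  exact ⟨φ, hφ, fun x => mem_filter.1 (hmem x)⟩

/-- Hence for every up-set `𝒲`: `#(𝒲 ∩ sources) ≤ #(𝒲 ∩ 𝒴)`. [this work] -/
theorem card_inter_srcSet_le {𝒴 𝒱 : Finset (Finset α)} (h𝒴 : IsUpperSet (𝒴 : Set (Finset α)))
    (h𝒱 : IsUpperSet (𝒱 : Set (Finset α))) {𝒲 : Finset (Finset α)} (h𝒲 : IsUpperSet (𝒲 : Set (Finset α))) :
    #(𝒲 ∩ srcSet 𝒴 𝒱) ≤ #(𝒲 ∩ 𝒴) := by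
  obtain ⟨φ, hφ, hmem⟩ := exists_core_injection h𝒴 h𝒱
  let ψ : Finset α → Finset α := fun S => if h : S ∈ srcSet 𝒴 𝒱 then φ ⟨S, h⟩ else S
  refine card_le_card_of_injOn ψ (fun S hS => ?_) (fun S hS S' hS' hSS' => ?_)
  · rw [mem_coe, mem_inter] at hS ⊢
    have e : ψ S = φ ⟨S, hS.2⟩ := dif_pos hS.2
    rw [e]
    exact ⟨h𝒲 (hmem ⟨S, hS.2⟩).2 hS.1, (hmem ⟨S, hS.2⟩).1⟩
  · rw [mem_coe, mem_inter] at hS hS'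
    have e : ψ S = φ ⟨S, hS.2⟩ := dif_pos hS.2
    have e' : ψ S' = φ ⟨S', hS'.2⟩ := dif_pos hS'.2
    rw [e, e'] at hSS'
    exact congrArg Subtype.val (hφ hSS')

/-- **THE CORE HOLDS** (this work): `CoreOn α` for every finite ground type — `0 ≤ ∑_S 𝟙[S∈𝒲]·coreFn 𝒴 𝒱 S` for all
up-sets `𝒲` and nested up-sets `𝒴 ⊆ 𝒱`.  (`∑ = #(𝒲∩𝒴) − #(𝒲∩σ𝒱) + #(𝒲∩C)` and `σ𝒱 ⊆ sources ∪ C`.) [this work] -/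
theorem coreOn_holds : CoreOn α := by
  intro 𝒲 𝒴 𝒱 h𝒲 h𝒴 h𝒱 _
  rw [sum_chi_mul_coreFn]
  have h1 := card_inter_srcSet_le h𝒴 h𝒱 h𝒲
  have h2 : #(𝒲 ∩ 𝒱ᶜˢ) ≤ #(𝒲 ∩ srcSet 𝒴 𝒱) + #(𝒲 ∩ corrSet 𝒴 𝒱) := by
    calc #(𝒲 ∩ 𝒱ᶜˢ) ≤ #(𝒲 ∩ srcSet 𝒴 𝒱 ∪ 𝒲 ∩ corrSet 𝒴 𝒱) := by
          refine card_le_card fun S hS => ?_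
          rw [mem_inter] at hS
          rw [mem_union, mem_inter, mem_inter, mem_srcSet]
          by_cases h : S ∈ corrSet 𝒴 𝒱
          · exact Or.inr ⟨hS.1, h⟩
          · exact Or.inl ⟨hS.1, mem_compls.1 hS.2, h⟩
      _ ≤ #(𝒲 ∩ srcSet 𝒴 𝒱) + #(𝒲 ∩ corrSet 𝒴 𝒱) := card_union_le _ _
  have h3 : corrSet 𝒴 𝒱 = univ.filter fun T : Finset α => (∃ e ∈ 𝒱 \ 𝒴, T ⊆ e) ∧ (∃ e ∈ 𝒱 \ 𝒴, e ⊆ Tᶜ) := rfl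
  rw [h3] at h2
  omega

end Matching

/-! ### Consequences: the whole Hall-form tower and the three-set antipodal inequality -/

/-- **`CorePair` holds**: the core on every cube `2^[n]`. [this work] -/
theorem corePair_holds : CorePair := fun _ => coreOn_holds

/-- **`ThreeSetHallD` holds** (the two-up-set core `Kl(𝒲,𝒱) ≥ Kl(𝒲∩𝒟,𝒰)`). [this work] -/
theorem threeSetHallD_holds : ThreeSetHallD := threeSetHallD_of_corePair corePair_holds

/-- **`ThreeSetHallG2` holds**. [this work] -/
theorem threeSetHallG2_holds : ThreeSetHallG2 := threeSetHallG2_of_threeSetHallD threeSetHallD_holds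

/-- **`ThreeSetHallG` holds**. [this work] -/
theorem threeSetHallG_holds : ThreeSetHallG := threeSetHallG_of_threeSetHallG2 threeSetHallG2_holds

/-- **`ThreeSetHall` holds**. [this work] -/
theorem threeSetHall_holds : ThreeSetHall := threeSetHall_of_threeSetHallG threeSetHallG_holds

/-- **`ThreeSetAntipodal` holds**: `threeSetN 𝒜 ℬ 𝒞 ≥ 0` for all up-sets of every finite cube. [this work] -/
theorem threeSetAntipodal_holds : ThreeSetAntipodal := threeSetAntipodal_of_corePair corePair_holds

/-- `threeSetN 𝒜 ℬ 𝒞 ≥ 0` for all up-sets `𝒜, ℬ, 𝒞` of `2^β`, every finite `β` (transport of `threeSetAntipodal_holds`). [this work] -/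
theorem threeSetN_nonneg {β : Type*} [DecidableEq β] [Fintype β] (𝒜 ℬ 𝒞 : Finset (Finset β))
    (h𝒜 : IsUpperSet (𝒜 : Set (Finset β))) (hℬ : IsUpperSet (ℬ : Set (Finset β))) (h𝒞 : IsUpperSet (𝒞 : Set (Finset β))) :
    0 ≤ threeSetN 𝒜 ℬ 𝒞 :=
  threeSetN_nonneg_of_threeSetAntipodal threeSetAntipodal_holds 𝒜 ℬ 𝒞 h𝒜 hℬ h𝒞

/-- **SQKD for every product measure, unconditionally** (this work + `…TwoPartitionFibre.sqkd_of_threeSetAntipodal`): for weights `w_i ∈ [0,1]`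
and up-sets `𝒜, ℬ, 𝒞` of `2^α`:  `P(𝒜∩ℬ)·P(𝒜∩𝒞) + P𝒜·P(ℬ∩𝒞) ≤ (1 + P𝒜)·P(𝒜∩ℬ∩𝒞)`, i.e. `Cov(1_{A∩B}, 1_{A∩C}) ≥ P(A)·P(Aᶜ∩B∩C)`
for increasing events under a product measure. [this work] -/
theorem sqkd {α : Type*} [DecidableEq α] [Fintype α] {w : α → ℝ} (hw : ∀ i, 0 ≤ w i ∧ w i ≤ 1) (𝒜 ℬ 𝒞 : Finset (Finset α))
    (h𝒜 : IsUpperSet (𝒜 : Set (Finset α))) (hℬ : IsUpperSet (ℬ : Set (Finset α))) (h𝒞 : IsUpperSet (𝒞 : Set (Finset α))) :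
    prob w (𝒜 ∩ ℬ) * prob w (𝒜 ∩ 𝒞) + prob w 𝒜 * prob w (ℬ ∩ 𝒞) ≤ (1 + prob w 𝒜) * prob w (𝒜 ∩ ℬ ∩ 𝒞) :=
  sqkd_of_threeSetAntipodal threeSetAntipodal_holds hw 𝒜 ℬ 𝒞 h𝒜 hℬ h𝒞

end Summit.CriticalPhenomena.PercolationContinuityZ3.Theorems.TwoPartition
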